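import Summits.CriticalPhenomena.Ising3DConformalLimit.Theorems.ArmDressingArmDressingGlueDefs
import Summits.CriticalPhenomena.Ising3DConformalLimit.Theorems.ArmDressingEvenPatternDecouplingArmBoxLimits
import Summits.CriticalPhenomena.Ising3DConformalLimit.Theorems.MoebiusLimitExists.Negative.ScaleFree
import Literature.Probability.LatticeModels.CriticalFKIsingConnectionLawsBox
import HarnessLib

/-!
# Crux `ArmDressingGlue` (stmt-CriticalPhenomena-15700), stub 3' — part 1: ball systems, exact dilations,
# monotonicity of the connection laws and the one-arm ratio

Toolkit for the Camia–Feng §3.2.3 bookkeeping (lead's stub `stub_dressedInversionCovarianceOfPos` of the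
skeleton `Cruxes/ArmDressingGlue/Lines/birth.lean`), over the vocabulary of
`Theorems/ArmDressingArmDressingGlueDefs.lean`:

* §1 generalised-ball data: the `n + n` configuration "inner closed balls ++ outer exteriors" as data for
  crux A (`disc_gball_append`) and its image under `ginv` (`ginv_append`, `ginv_neg_radius`);
* §2 the connection laws `Pr m K R` of finite/co-finite probe families are limits of the box laws
  (`tendsto_PrL`, from `Literature.…CriticalFKIsingConnectionLawsBox`), lie in `[0,1]`, and are monotone in
  the probe sets for monotone relation sets such as `CROSS n` (`Pr_mono_set`);
* §3 EXACT lattice dilations: `disc δ (κ•A) = disc (δ/κ) A` for balls and exteriors, `latticeApprox δ (κz) =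
  latticeApprox (δ/κ) z`, `arm1 (δ/κ) 1 = arm1 δ κ`;
* §4 the one-arm ratio: for a `ρ₁`-limit `S` that is scale covariant with dimension `Δ` and non-degenerate,
  `arm1(δ/κ,1)/arm1(δ,1) → κ^{-Δ}` (`tendsto_arm1_ratio`), by the tree's `tendsto_rho_ratio` /
  `smul_eq_ratio_pow_mul` (`MoebiusLimitExists/Negative/ScaleFree.lean`).

Registered bookkeeping stub proved here: `stub_invSystems` (§4).  No definitions, no named facts, no sorry.

Reference: F. Camia, Y. Feng, arXiv:2411.01467, Lemma 17 and §3.2.3.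
-/

noncomputable section

namespace Summit.CriticalPhenomena.Ising3DConformalLimit.Cruxes.ArmDressingGlue.InvBook

open scoped BigOperators Topology
open Filter Set Metric
open Literature.Probability.LatticeModels Literature.Probability.Percolation
open Literature.Barriers.CriticalPhenomena
open Summit.CriticalPhenomena.Ising3DConformalLimit.Theses
open Summit.CriticalPhenomena.Ising3DConformalLimit.Cruxes.ArmDressingGlue.Vocab

/-! ### §1 Generalised-ball data -/

/-- Post-composition distributes over `Fin.append`. [folklore] -/
theorem comp_fin_append {α β : Type*} {m n : ℕ} (h : α → β) (f : Fin m → α) (g : Fin n → α) :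
    (fun i => h (Fin.append f g i)) = Fin.append (fun j => h (f j)) (fun j => h (g j)) := by
  funext i
  refine Fin.addCases (fun j => ?_) (fun j => ?_) i
  · simp only [Fin.append_left]
  · simp only [Fin.append_right]

/-- The discretised generalised balls of the data "inner `(cᵢ, ρᵢ)` with `ρᵢ > 0` ++ outer `(c'ᵢ, -Rᵢ)` with
`Rᵢ > 0`" are the family `fam` of inner closed balls and outer closed exteriors. [folklore] -/
theorem disc_gball_append {n : ℕ} (δ : ℝ) (ci : Fin n → EuclideanSpace ℝ (Fin 3)) (ρ : Fin n → ℝ)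
    (co : Fin n → EuclideanSpace ℝ (Fin 3)) (R : Fin n → ℝ) (hρ : ∀ j, 0 < ρ j) (hR : ∀ j, 0 < R j) :
    (fun i => disc δ (gball (Fin.append (fun j => (ci j, ρ j)) (fun j => (co j, -R j)) i))) =
      fam n δ (fun j => closedBall (ci j) (ρ j)) (fun j => (ball (co j) (R j))ᶜ) := by
  rw [comp_fin_append (fun p => disc δ (gball p))]
  unfold fam
  congr 1
  · funext j
    rw [gball_of_pos (hρ j)]
  · funext j
    rw [gball_of_not_pos (by simp only [not_lt, neg_nonpos]; exact (hR j).le), neg_neg]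

/-- `ginv` acts memberwise on appended data. [folklore] -/
theorem ginv_append {m n : ℕ} (P : Fin m → EuclideanSpace ℝ (Fin 3) × ℝ)
    (Q : Fin n → EuclideanSpace ℝ (Fin 3) × ℝ) :
    (fun i => ginv (Fin.append P Q i)) = Fin.append (fun j => ginv (P j)) (fun j => ginv (Q j)) :=
  comp_fin_append ginv P Q

/-- The image datum of `(c, ρ)`: centre `c/(‖c‖² - ρ²)`, radius `ρ/(‖c‖² - ρ²)`. [folklore] -/
theorem ginv_mk (c : EuclideanSpace ℝ (Fin 3)) (ρ : ℝ) :
    ginv (c, ρ) = ((‖c‖ ^ 2 - ρ ^ 2)⁻¹ • c, ρ / (‖c‖ ^ 2 - ρ ^ 2)) := rfl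

/-- Opposite radius, same sphere: `ginv (c, -ρ) = (centre, -radius)` of `ginv (c, ρ)`. [folklore] -/
theorem ginv_neg_radius (c : EuclideanSpace ℝ (Fin 3)) (ρ : ℝ) :
    ginv (c, -ρ) = ((‖c‖ ^ 2 - ρ ^ 2)⁻¹ • c, -(ρ / (‖c‖ ^ 2 - ρ ^ 2))) := by
  rw [ginv_mk, neg_sq, neg_div]

/-- The image radius is positive for `0 < ρ < ‖c‖`. [folklore] -/
theorem ginv_radius_pos {c : EuclideanSpace ℝ (Fin 3)} {ρ : ℝ} (hρ : 0 < ρ) (h : ρ < ‖c‖) :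
    0 < ρ / (‖c‖ ^ 2 - ρ ^ 2) := by
  refine div_pos hρ ?_
  have : ρ ^ 2 < ‖c‖ ^ 2 := by gcongr
  linarith

/-! ### §2 The connection laws of finite/co-finite probe families -/

/-- For probe families each finite or co-finite the box laws converge to `Pr` (thermodynamic limit of the
critical FK-Ising connection laws, `tendsto_rcMeasure_real_connRelLaw_criticalBeta_box`).
[cite: Grimmett2006, Thm. (4.19)] -/
theorem tendsto_PrL {m : ℕ} {K : Fin m → Set (Site 3)} (hK : ∀ i, (K i).Finite ∨ (K i)ᶜ.Finite)
    (R : Set (Fin m → Fin m → Prop)) : Tendsto (PrL m K R) atTop (𝓝 (Pr m K R)) := by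
  obtain ⟨ℓ, hℓ⟩ := tendsto_rcMeasure_real_connRelLaw_criticalBeta_box (d := 3) le_rfl hK R
  have h : Tendsto (PrL m K R) atTop (𝓝 ℓ) := hℓ
  have hPr : Pr m K R = ℓ := h.limUnder_eq
  rw [hPr]
  exact h

/-- Such connection laws are probabilities: `0 ≤ Pr ≤ 1`. [folklore] -/
theorem Pr_mem_Icc {m : ℕ} {K : Fin m → Set (Site 3)} (hK : ∀ i, (K i).Finite ∨ (K i)ᶜ.Finite)
    (R : Set (Fin m → Fin m → Prop)) : Pr m K R ∈ Set.Icc (0:ℝ) 1 :=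
  ⟨ge_of_tendsto' (tendsto_PrL hK R) fun L => PrL_nonneg m K R L,
    le_of_tendsto' (tendsto_PrL hK R) fun L => PrL_le_one m K R L⟩

/-- Box laws are monotone in the probe sets for relation sets closed upwards. [folklore] -/
theorem PrL_mono_set {m : ℕ} {K K' : Fin m → Set (Site 3)} (hKK' : ∀ i, K i ⊆ K' i)
    {R : Set (Fin m → Fin m → Prop)}
    (hR : ∀ ρ ρ' : Fin m → Fin m → Prop, ρ ∈ R → (∀ i j, ρ i j → ρ' i j) → ρ' ∈ R) (L : ℕ) :
    PrL m K R L ≤ PrL m K' R L := by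
  refine MeasureTheory.measureReal_mono (fun ω hω => ?_) (MeasureTheory.measure_ne_top _ _)
  refine hR _ _ hω fun i j => ?_
  rintro ⟨x, y, hx, hy, hxy⟩
  exact ⟨x, y, hKK' i hx, hKK' j hy, hxy⟩

/-- … hence so are the limiting laws (finite/co-finite probes). [folklore] -/
theorem Pr_mono_set {m : ℕ} {K K' : Fin m → Set (Site 3)} (hK : ∀ i, (K i).Finite ∨ (K i)ᶜ.Finite)
    (hK' : ∀ i, (K' i).Finite ∨ (K' i)ᶜ.Finite) (hKK' : ∀ i, K i ⊆ K' i) {R : Set (Fin m → Fin m → Prop)}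
    (hR : ∀ ρ ρ' : Fin m → Fin m → Prop, ρ ∈ R → (∀ i j, ρ i j → ρ' i j) → ρ' ∈ R) :
    Pr m K R ≤ Pr m K' R :=
  le_of_tendsto_of_tendsto' (tendsto_PrL hK R) (tendsto_PrL hK' R) fun L => PrL_mono_set hKK' hR L

/-- `CROSS n` is closed upwards. [folklore] -/
theorem cross_upward {n : ℕ} (ρ ρ' : Fin (n + n) → Fin (n + n) → Prop) (hρ : ρ ∈ CROSS n)
    (h : ∀ i j, ρ i j → ρ' i j) : ρ' ∈ CROSS n :=
  fun i => h _ _ (hρ i)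

/-- Discretised bounded sets are finite (`δ > 0`). [folklore] -/
theorem finite_disc {δ : ℝ} (hδ : 0 < δ) {A : Set (EuclideanSpace ℝ (Fin 3))} (hA : Bornology.IsBounded A) :
    (disc δ A).Finite :=
  Summit.CriticalPhenomena.Ising3DConformalLimit.Theorems.EvenPatternDecoupling.finite_disc_of_isBounded hδ hA

/-- Discretised exteriors of bounded sets are co-finite (`δ > 0`). [folklore] -/
theorem cofinite_disc_compl {δ : ℝ} (hδ : 0 < δ) {A : Set (EuclideanSpace ℝ (Fin 3))}
    (hA : Bornology.IsBounded A) : (disc δ Aᶜ)ᶜ.Finite := by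
  have : (disc δ Aᶜ)ᶜ = disc δ A := by ext x; simp [disc]
  rw [this]
  exact finite_disc hδ hA

/-- The members of `fam n δ (closed balls) (exteriors of balls)` are finite or co-finite (`δ > 0`). [folklore] -/
theorem fam_finite_or_cofinite {n : ℕ} {δ : ℝ} (hδ : 0 < δ) (ci : Fin n → EuclideanSpace ℝ (Fin 3))
    (ρ : Fin n → ℝ) (co : Fin n → EuclideanSpace ℝ (Fin 3)) (R : Fin n → ℝ) :
    ∀ i, (fam n δ (fun j => closedBall (ci j) (ρ j)) (fun j => (ball (co j) (R j))ᶜ) i).Finite ∨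
      (fam n δ (fun j => closedBall (ci j) (ρ j)) (fun j => (ball (co j) (R j))ᶜ) i)ᶜ.Finite := by
  intro i
  refine Fin.addCases (fun j => ?_) (fun j => ?_) i
  · left
    simp only [fam, Fin.append_left]
    exact finite_disc hδ isBounded_closedBall
  · right
    simp only [fam, Fin.append_right]
    exact cofinite_disc_compl hδ isBounded_ball

/-- **Monotonicity of the CROSS law in the outer sets**: enlarging every outer set (shrinking the middle
balls) increases `Pr[CROSS]`. [folklore] -/
theorem Pr_cross_mono_outer {n : ℕ} {δ : ℝ} (hδ : 0 < δ) (ci : Fin n → EuclideanSpace ℝ (Fin 3))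
    (ρ : Fin n → ℝ) (co co' : Fin n → EuclideanSpace ℝ (Fin 3)) (R R' : Fin n → ℝ)
    (h : ∀ j, ball (co' j) (R' j) ⊆ ball (co j) (R j)) :
    Pr (n + n) (fam n δ (fun j => closedBall (ci j) (ρ j)) (fun j => (ball (co j) (R j))ᶜ)) (CROSS n) ≤
      Pr (n + n) (fam n δ (fun j => closedBall (ci j) (ρ j)) (fun j => (ball (co' j) (R' j))ᶜ)) (CROSS n) := by
  refine Pr_mono_set (fam_finite_or_cofinite hδ ci ρ co R) (fam_finite_or_cofinite hδ ci ρ co' R')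
    (fun i => ?_) cross_upward
  refine Fin.addCases (fun j => ?_) (fun j => ?_) i
  · simp only [fam, Fin.append_left]; rfl
  · simp only [fam, Fin.append_right]
    intro x hx
    simp only [mem_disc, mem_compl_iff] at hx ⊢
    exact fun hx' => hx (h j hx')

/-! ### §3 Exact lattice dilations -/

/-- `mesh (δ/κ) x = κ⁻¹ • mesh δ x`. [folklore] -/
theorem mesh_div (δ κ : ℝ) (x : Site 3) : mesh (δ / κ) x = κ⁻¹ • mesh δ x := by
  rw [mesh_eq_smul, mesh_eq_smul δ, smul_smul, div_eq_inv_mul]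

/-- Exact dilation of discretised closed balls: `disc δ B̄(κc, κρ) = disc (δ/κ) B̄(c, ρ)`. [folklore] -/
theorem disc_closedBall_dilate {κ : ℝ} (hκ : 0 < κ) (δ : ℝ) (c : EuclideanSpace ℝ (Fin 3)) (ρ : ℝ) :
    disc δ (closedBall (κ • c) (κ * ρ)) = disc (δ / κ) (closedBall c ρ) := by
  ext x
  simp only [mem_disc, mem_closedBall, dist_eq_norm, mesh_div δ κ]
  have : mesh δ x - κ • c = κ • (κ⁻¹ • mesh δ x - c) := by
    rw [smul_sub, smul_smul, mul_inv_cancel₀ hκ.ne', one_smul]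
  rw [this, norm_smul, Real.norm_eq_abs, abs_of_pos hκ]
  exact ⟨fun h => le_of_mul_le_mul_left h hκ, fun h => mul_le_mul_of_nonneg_left h hκ.le⟩

/-- Exact dilation of discretised exteriors: `disc δ (B(κc, κρ))ᶜ = disc (δ/κ) (B(c, ρ))ᶜ`. [folklore] -/
theorem disc_ball_compl_dilate {κ : ℝ} (hκ : 0 < κ) (δ : ℝ) (c : EuclideanSpace ℝ (Fin 3)) (ρ : ℝ) :
    disc δ (ball (κ • c) (κ * ρ))ᶜ = disc (δ / κ) (ball c ρ)ᶜ := by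
  ext x
  simp only [mem_disc, mem_compl_iff, mem_ball, dist_eq_norm, mesh_div δ κ, not_lt]
  have : mesh δ x - κ • c = κ • (κ⁻¹ • mesh δ x - c) := by
    rw [smul_sub, smul_smul, mul_inv_cancel₀ hκ.ne', one_smul]
  rw [this, norm_smul, Real.norm_eq_abs, abs_of_pos hκ]
  exact ⟨fun h => le_of_mul_le_mul_left h hκ, fun h => mul_le_mul_of_nonneg_left h hκ.le⟩

/-- Exact dilation of lattice approximations: `[κz/δ] = [z/(δ/κ)]`. [folklore] -/
theorem latticeApprox_dilate {κ : ℝ} (hκ : 0 < κ) (δ : ℝ) (p : EuclideanSpace ℝ (Fin 3)) :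
    latticeApprox δ (κ • p) = latticeApprox (δ / κ) p := by
  have h := MoebiusLimitExistsNegative.latticeApprox_smul_smul hκ (δ / κ) p
  rwa [mul_div_cancel₀ _ hκ.ne'] at h

/-- Exact dilation of the point probes. [folklore] -/
theorem pts_dilate {n : ℕ} {κ : ℝ} (hκ : 0 < κ) (δ : ℝ) (z : Fin n → EuclideanSpace ℝ (Fin 3)) :
    pts n δ (fun j => κ • z j) = pts n (δ / κ) z := by
  funext j
  simp only [pts, latticeApprox_dilate hκ]

/-- Exact dilation of a `fam` of inner closed balls and outer exteriors. [folklore] -/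
theorem fam_dilate {n : ℕ} {κ : ℝ} (hκ : 0 < κ) (δ : ℝ) (ci : Fin n → EuclideanSpace ℝ (Fin 3))
    (ρ : Fin n → ℝ) (co : Fin n → EuclideanSpace ℝ (Fin 3)) (R : Fin n → ℝ) :
    fam n δ (fun j => closedBall (κ • ci j) (κ * ρ j)) (fun j => (ball (κ • co j) (κ * R j))ᶜ) =
      fam n (δ / κ) (fun j => closedBall (ci j) (ρ j)) (fun j => (ball (co j) (R j))ᶜ) := by
  unfold fam
  congr 1
  · funext j; exact disc_closedBall_dilate hκ δ (ci j) (ρ j)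
  · funext j; exact disc_ball_compl_dilate hκ δ (co j) (R j)

/-- Exact dilation of the one-arm probability: `arm1 (δ/κ) 1 = arm1 δ κ`. [folklore] -/
theorem arm1_dilate {κ : ℝ} (hκ : 0 < κ) (δ : ℝ) : arm1 (δ / κ) 1 = arm1 δ κ := by
  simp only [arm1]
  have h := disc_ball_compl_dilate hκ δ (0 : EuclideanSpace ℝ (Fin 3)) 1
  rw [smul_zero, mul_one] at h
  rw [← h]

/-- `δ ↦ δ/κ` maps `0⁺` to `0⁺`. [folklore] -/
theorem tendsto_div_const_nhdsGT {κ : ℝ} (hκ : 0 < κ) :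
    Tendsto (fun δ : ℝ => δ / κ) (𝓝[>] (0:ℝ)) (𝓝[>] 0) := by
  have h := MoebiusLimitExistsNegative.tendsto_const_mul_nhdsGT (inv_pos.2 hκ)
  refine h.congr fun δ => ?_
  rw [div_eq_inv_mul]

/-! ### §4 The one-arm ratio of a scale-covariant `ρ₁`-limit -/

/-- `ρ₁ > 0` on `(0,1]` from `Arm1Pos`. [folklore] -/
theorem rho1_pos (hpos : Arm1Pos) : ∀ δ ∈ Set.Ioc (0:ℝ) 1, 0 < rho1 δ :=
  fun δ hδ => inv_pos.2 (hpos δ hδ)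

/-- For a non-degenerate `ρ`-limit that is scale covariant with dimension `Δ`, the renormalisation ratio of
the tree (`tendsto_rho_ratio`) is the power `c^{-Δ}`: `ρ(cδ)/ρ(δ) → c^{-Δ}`. [folklore] -/
theorem tendsto_rho_ratio_rpow {ρ : ℝ → ℝ} {S : CorrFamily 3} {Δ : ℝ}
    (hρ : ∀ δ ∈ Set.Ioc (0:ℝ) 1, 0 < ρ δ) (hlim : HasPointwiseScalingLimit (criticalCorr 3) ρ S)
    (hnd : IsNondegenerateTwoPoint S) (hsc : IsScaleCovariant Δ S) {c : ℝ} (hc : 0 < c) :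
    Tendsto (fun δ => ρ (c * δ) / ρ δ) (𝓝[>] (0:ℝ)) (𝓝 (c ^ (-Δ))) := by
  set Φ : ℝ := Real.sqrt (S 2 ![0, EuclideanSpace.single 0 1] /
    S 2 ![0, c⁻¹ • EuclideanSpace.single 0 1]) with hΦ
  have hΦ0 : 0 ≤ Φ := Real.sqrt_nonneg _
  -- `Φ² = c^{-2Δ}` from the two expressions of `S₂(c·z₀)`
  set z₀ : Fin 2 → EuclideanSpace ℝ (Fin 3) := ![0, EuclideanSpace.single 0 1] with hz₀
  have hz₀m : z₀ ∈ NonCoincident 3 2 := by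
    have := MoebiusLimitExistsNegative.axis_mem_nonCoincident (t := 1) one_ne_zero
    simpa [hz₀] using this
  have h1 : S 2 (fun i => c • z₀ i) = Φ ^ 2 * S 2 z₀ :=
    MoebiusLimitExistsNegative.smul_eq_ratio_pow_mul hρ hlim hnd hc hz₀m
  have h2 : S 2 (fun i => c • z₀ i) = c ^ (-(2 : ℕ) * Δ : ℝ) * S 2 z₀ := by
    have := hsc 2 c hc z₀
    simpa using this
  have hS : 0 < S 2 z₀ := hnd _ hz₀m
  have hsq : Φ ^ 2 = c ^ (-(2 : ℕ) * Δ : ℝ) := by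
    have := h1.symm.trans h2
    exact mul_right_cancel₀ hS.ne' this
  have hpow : c ^ (-(2 : ℕ) * Δ : ℝ) = (c ^ (-Δ)) ^ 2 := by
    rw [show (-(2 : ℕ) * Δ : ℝ) = (-Δ) * 2 by push_cast; ring, Real.rpow_mul hc.le, Real.rpow_two]
  have hΦeq : Φ = c ^ (-Δ) := by
    rw [hpow] at hsq
    exact (sq_eq_sq₀ hΦ0 (Real.rpow_nonneg hc.le _)).1 hsq
  rw [← hΦeq]
  exact MoebiusLimitExistsNegative.tendsto_rho_ratio hρ hlim hnd hc

/-- **The one-arm ratio.**  If the critical correlators renormalised by `ρ₁ = 1/arm1(·,1)` converge to a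
non-degenerate `S` that is scale covariant with dimension `Δ`, then `arm1(δ/κ, 1)/arm1(δ, 1) → κ^{-Δ}`
as `δ → 0⁺`, for every `κ > 0` (Camia–Feng Lemma 17: the one-arm exponent is the spin dimension).
[cite: CamiaFeng2025, Lemma 17] -/
theorem tendsto_arm1_ratio {S : CorrFamily 3} {Δ : ℝ} (hpos : Arm1Pos)
    (hlim : HasPointwiseScalingLimit (criticalCorr 3) rho1 S) (hnd : IsNondegenerateTwoPoint S)
    (hsc : IsScaleCovariant Δ S) {κ : ℝ} (hκ : 0 < κ) :
    Tendsto (fun δ => arm1 (δ / κ) 1 / arm1 δ 1) (𝓝[>] (0:ℝ)) (𝓝 (κ ^ (-Δ))) := by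
  have hρ := rho1_pos hpos
  -- `ρ₁(κ⁻¹δ)/ρ₁(δ) = arm1(δ,1)/arm1(δ/κ,1) → (κ⁻¹)^{-Δ} = κ^Δ`
  have h := tendsto_rho_ratio_rpow hρ hlim hnd hsc (inv_pos.2 hκ)
  have hval : (κ⁻¹) ^ (-Δ) = κ ^ Δ := by
    rw [Real.inv_rpow hκ.le, ← Real.rpow_neg hκ.le, neg_neg]
  rw [hval] at h
  have h' : Tendsto (fun δ => arm1 δ 1 / arm1 (δ / κ) 1) (𝓝[>] (0:ℝ)) (𝓝 (κ ^ Δ)) := by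
    refine h.congr fun δ => ?_
    simp only [rho1, inv_div_inv]
    rw [div_eq_inv_mul δ κ]
  have hκΔ : κ ^ Δ ≠ 0 := (Real.rpow_pos_of_pos hκ Δ).ne'
  have h'' := h'.inv₀ hκΔ
  refine (h''.congr fun δ => ?_).trans ?_
  · simp only [inv_div]
  · rw [← Real.rpow_neg hκ.le]

/-- Registered bookkeeping stub `stub_invSystems` of the skeleton (the one-arm ratio of §4), through which
this toolkit file lands. [cite: CamiaFeng2025, Lemma 17] -/
theorem stub_invSystems : Arm1Pos → ∀ (Δ : ℝ) (S : CorrFamily 3), HasPointwiseScalingLimit (criticalCorr 3) rho1 S → IsNondegenerateTwoPoint S → IsScaleCovariant Δ S → ∀ κ : ℝ, 0 < κ → Tendsto (fun δ => arm1 (δ / κ) 1 / arm1 δ 1) (𝓝[>] (0:ℝ)) (𝓝 (κ ^ (-Δ))) :=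
  fun hpos _ _ hlim hnd hsc _ hκ => tendsto_arm1_ratio hpos hlim hnd hsc hκ

end Summit.CriticalPhenomena.Ising3DConformalLimit.Cruxes.ArmDressingGlue.InvBook

end
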